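import Summits.HodgeConjecture.HodgeConjecture.Theorems.Ring2HypothesesWeilComponentsCM
import HarnessLib

/-!
# Ring 2 — hypotheses layer, part XI-B: the LOCAL GERM of algebraic fibres on the `(E, 2k, δ)`-components for a CM field `E`, `[E:ℚ] ≥ 4`, with an abstract anchor

HONEST FRAMING: research route conditional on HC_CM; not a corollary; Q11.4-sentence-2 already refuted in dim ≥ 3.

Cell `pub-hodge-ring2`, seat `pub-hodge-ring2-typer2`, gen 7. `HC_CM` is ALWAYS the binder
`(hCM : Theses.RankFourFaces.CMAbelianHodge)` (stmt-HodgeConjecture-3052), never an axiom, never cited as known.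
Nothing in this file proves a case of the Hodge conjecture: every row is an implication between NAMED typed inputs;
the unconditional lemmas are on-path lemmas, antitonicity, and one point-set equivalence over the tree's Baire /
Charles–Schnell lemma (`WeilTypeLadder.mem_algebraicClasses_of_isOpen_subset_algebraicityLocus`).

## What this part adds (the CM-field twin of part XI-A `Ring2HypothesesWeilComponentsGerm`)

Part VII-C (`Ring2HypothesesWeilComponentsCM`) indexes the Weil classes over a CM field `E = ℚ[T]/(R(T²)) ⊃ F`,
`[E:ℚ] = 2e₀ ≥ 4`, by the component `(E, d = 2k, δ = disc φ ∈ Fˣ/Nm_{E/F}(Eˣ))` (Deligne LNM 900 §4 p. 30 (1),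
Lemma 4.6; Landherr 1936) and transports algebraicity from an anchor fibre by the GLOBAL δ-restricted leaf
`WeilVariationalHodgeComponentCM R e₀ k δ`. Here the transport input is the LOCAL GERM, typed once over an abstract
anchor (the output shape of STRICT semiregularity, Buchweitz–Flenner Thm. 5.1/5.2, at a semiregular representative on
the anchor fibre — NOT the weak criterion of Question 11.4 sentence 2, refuted in dim ≥ 3):

* `LocalWeilVHCAtComponentCM R e₀ k δ anchor` (schema); instances `LocalWeilVHCAtCMComponentCM` (CM-presented fibres of
  dimension `2k·e₀`, anchor `cmAnchorOfDim (2k·e₀) k`) and `LocalWeilVHCComponentCM` (every algebraic fibre).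
* antitone in the anchor; the global leaf implies every local one; ON-PATH lemmas; EXACTNESS
  `weilVariationalHodgeComponentCM_iff_local : W-VHC(δ)-CM ⟺ LocalWeilVHCComponentCM` (openness of the algebraicity germ).
* LOCAL anchor engine `weilClassesComponentCM_of_pointed_of_local`; rows W1-CM-loc (`HC_CM` + CM-pointed + local at CM
  fibres; `HC_CM` NOMINAL), W1′-CM-loc (`HC_CM`-FREE: divisor-generated CM-pointed + local at divisor-generated CM / at
  CM fibres), W1″-CM-loc (anchored + local at algebraic fibres).

HONEST COLUMN. Every local leaf below is OPEN for every component with `e₀ ≥ 2` — no semiregular or secant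
representative of a Weil class over a CM field of degree `≥ 4` is known in print (C. Voisin, JOMP 2025 survey §3.3:
the known Weil-type results are Schoen 1988/1998, Markman 2023, Markman 2025, all over imaginary quadratic fields).
`HC_CM` is nominal on W1-CM-loc exactly as on W1-CM. T6(δ)-CM from the local rows is the composition with part VII-D's
`hodgeGeneralWeilTypeComponentCM_of_weilClassesComponentCM` (fact #24 + Moonen–Zarhin), not restated here.

## References

* [BuchweitzFlenner2003] Compositio Math. 137 (2003), Thm. 5.1, Thm. 5.2. [Bloch1972Semiregularity] Invent. Math. 17.
* [CharlesSchnell2014Notes] Conj. 11.3.1, Cor. 11.3.6, Prop. 11.3.11 (proof). [MumfordAV1970] §6 Lemma.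
* [Deligne1982HodgeCycles] LNM 900, §4 p. 30 (1), Prop. 4.1, Lemma 4.6, proof of Thm. 4.8 (a)–(c), §5.
* [Landherr1936HermitianForms]. [Mumford1969NoteShimura] §3. [Voisin2025HodgeConiveau] JOMP 1 (2025) §3.3 p. 20.
* [Markman2025SurveySecant] arXiv:2509.23403 (UNREFEREED), Question 11.4, §12.
-/

set_option linter.dupNamespace false

noncomputable section

open CategoryTheory
open Literature.AlgebraicGeometry Literature.AlgebraicGeometry.Motives
open Literature.AlgebraicGeometry.HodgeTheory
open Literature.AlgebraicGeometry.Deligne1982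
open Literature.AlgebraicTopology.SingularHomology
open Literature.AlgebraicGeometry.Milne1999 (IsOfCMType)
open Literature.AlgebraicGeometry.VanGeemen1994 (pullbackOne)
open Summit.HodgeConjecture.HodgeConjecture.WeilTypeLadder
open Summit.HodgeConjecture.HodgeConjecture.Theses
open Summit.HodgeConjecture.HodgeConjecture.Ring2Transport

namespace Summit.HodgeConjecture.HodgeConjecture.Ring2.Hypotheses

/-! ### §1 The δ-restricted local germ over an abstract anchor (CM field), and its two named instances -/

section Indexed

variable (R : Polynomial ℤ) [Fact (Irreducible (realPolyQ R))] (e₀ k : ℕ) (δ : cmNormResidueGroup R)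

/-- **`LocalWeilVHCAtComponentCM R e₀ k δ anchor` — LOCAL δ-restricted Weil-confined variational Hodge AT ANCHOR
FIBRES of `(E, 2k, δ)`-Weil families (schema; Summit-side typed input, NOT a Literature fact).** In the binders of
`WeilVariationalHodgeComponentCM R e₀ k δ` (smooth projective `(E, 2k, δ)`-Weil family `f : 𝒳 ⟶ S` of relative
dimension `2k·e₀`, `𝒳`, `S` quasi-projective, `S` smooth irreducible, global `W` fibrewise rational of type `(k,k)`,
charts `HasWeilChartsOfDiscCM R e₀ k δ f W`): at every complex point `s₀` with `anchor 𝒳_{s₀} (W|)` and `W|_{𝒳_{s₀}}`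
ALGEBRAIC, a Euclidean-open `U ∋ s₀` with `W|_{𝒳_t}` algebraic for all `t ∈ U`. Antitone in `anchor`.
[cite: BuchweitzFlenner2003, Thm. 5.1 and Thm. 5.2] [cite: CharlesSchnell2014Notes, Conj. 11.3.1 and Prop. 11.3.11]
[cite: Deligne1982HodgeCycles, §4 proof of Thm. 4.8] -/
def LocalWeilVHCAtComponentCM (anchor : (X : SchemeOver ℂ) → complexBetti X (2 * k) → Prop) : Prop :=
  ∀ ⦃𝒳 S : SchemeOver ℂ⦄ (f : 𝒳 ⟶ S), IsSmoothProjectiveFamily f (2 * k * e₀) →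
    IsQuasiProjectiveOver 𝒳 → IsQuasiProjectiveOver S → IrreducibleSpace S.left →
    AlgebraicGeometry.Smooth S.hom →
    ∀ (W : complexBetti 𝒳 (2 * k)),
      (∀ s : ComplexPoints S,
        IsRationalClass (complexBetti.map (fiberι f s) (2 * k) W) ∧
          IsOfHodgeType (2 * k * e₀) (fiberOver f s) (2 * k) k k (complexBetti.map (fiberι f s) (2 * k) W)) →
      HasWeilChartsOfDiscCM R e₀ k δ f W →
      ∀ s₀ : ComplexPoints S, anchor (fiberOver f s₀) (complexBetti.map (fiberι f s₀) (2 * k) W) →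
        complexBetti.map (fiberι f s₀) (2 * k) W ∈ algebraicClasses (fiberOver f s₀) k →
        ∃ U : Set (ComplexPoints S), IsOpen U ∧ s₀ ∈ U ∧
          ∀ t ∈ U, complexBetti.map (fiberι f t) (2 * k) W ∈ algebraicClasses (fiberOver f t) k

/-- **`LocalWeilVHCAtCMComponentCM R e₀ k δ` — the local germ AT CM-PRESENTED FIBRES of `(E, 2k, δ)`-Weil families
(typed missing input; a CASE of the summit).** Anchor `cmAnchorOfDim (2k·e₀) k`. WEAKER than W-VHC(δ)-CM
(`localWeilVHCAtCMComponentCM_of_weilVariationalHodgeComponentCM`); OPEN for every component with `e₀ ≥ 2`.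
ON-PATH: `localWeilVHCAtCMComponentCM_of_hodgeConjecture`. [cite: BuchweitzFlenner2003, Thm. 5.1]
[cite: Deligne1982HodgeCycles, §4 proof of Thm. 4.8 and §5] [status: open] -/
@[conjecture] def LocalWeilVHCAtCMComponentCM : Prop :=
  LocalWeilVHCAtComponentCM R e₀ k δ (cmAnchorOfDim (2 * k * e₀) k)

/-- **`LocalWeilVHCComponentCM R e₀ k δ` — the local germ AT EVERY ALGEBRAIC FIBRE ("the algebraicity locus of `W` is
open") on `(E, 2k, δ)`-Weil families (typed missing input; a CASE of the summit).** EQUIVALENT to the global leaf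
W-VHC(δ)-CM over these bases (`weilVariationalHodgeComponentCM_iff_local`).
[cite: CharlesSchnell2014Notes, Conj. 11.3.1 and Prop. 11.3.11] [status: open] -/
@[conjecture] def LocalWeilVHCComponentCM : Prop :=
  LocalWeilVHCAtComponentCM R e₀ k δ (algebraicAnchor k)

end Indexed

/-! ### §2 Bookkeeping: antitonicity, the global leaf, on-path, exactness -/

variable {R : Polynomial ℤ} [Fact (Irreducible (realPolyQ R))] {e₀ k : ℕ} {δ : cmNormResidueGroup R}

/-- The local germ is ANTITONE in the anchor. [folklore] -/
theorem LocalWeilVHCAtComponentCM.anti {P Q : (X : SchemeOver ℂ) → complexBetti X (2 * k) → Prop}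
    (hPQ : ∀ X x, P X x → Q X x) (hL : LocalWeilVHCAtComponentCM R e₀ k δ Q) :
    LocalWeilVHCAtComponentCM R e₀ k δ P :=
  fun _ _ f hf h𝒳 hS hirrS hsm W hW hch s₀ hanch hs₀ ↦
    hL f hf h𝒳 hS hirrS hsm W hW hch s₀ (hPQ _ _ hanch) hs₀

/-- The GLOBAL δ-leaf implies the local germ at any anchor (`U = S(ℂ)`). [cite: CharlesSchnell2014Notes, Conj. 11.3.1] -/
theorem localWeilVHCAtComponentCM_of_weilVariationalHodgeComponentCM (hV : WeilVariationalHodgeComponentCM R e₀ k δ)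
    (anchor : (X : SchemeOver ℂ) → complexBetti X (2 * k) → Prop) : LocalWeilVHCAtComponentCM R e₀ k δ anchor :=
  fun _ _ f hf h𝒳 hS hirrS hsm W hW hch s₀ _ hs₀ ↦
    ⟨Set.univ, isOpen_univ, Set.mem_univ s₀, fun t _ ↦ hV f hf h𝒳 hS hirrS hsm W hW hch ⟨s₀, hs₀⟩ t⟩

/-- ON-PATH: the local germ at any anchor is a case of the summit (fibrewise, `U = S(ℂ)`).
[cite: CharlesSchnell2014Notes, Cor. 11.3.6] -/
theorem localWeilVHCAtComponentCM_of_hodgeConjecture (h : _root_.HodgeConjecture) (R : Polynomial ℤ)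
    [Fact (Irreducible (realPolyQ R))] (e₀ k : ℕ) (δ : cmNormResidueGroup R)
    (anchor : (X : SchemeOver ℂ) → complexBetti X (2 * k) → Prop) : LocalWeilVHCAtComponentCM R e₀ k δ anchor :=
  fun _ _ _ hf _ _ _ _ _ hW _ s₀ _ _ ↦
    ⟨Set.univ, isOpen_univ, Set.mem_univ s₀, fun t _ ↦ (h (hf.isSmoothProjective t)).2 k _ (hW t).1 (hW t).2⟩

/-- ON-PATH for the CM instance. [cite: CharlesSchnell2014Notes, Cor. 11.3.6] -/
theorem localWeilVHCAtCMComponentCM_of_hodgeConjecture (h : _root_.HodgeConjecture) (R : Polynomial ℤ)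
    [Fact (Irreducible (realPolyQ R))] (e₀ k : ℕ) (δ : cmNormResidueGroup R) :
    LocalWeilVHCAtCMComponentCM R e₀ k δ :=
  localWeilVHCAtComponentCM_of_hodgeConjecture h R e₀ k δ _

/-- ON-PATH for the algebraic instance. [cite: CharlesSchnell2014Notes, Cor. 11.3.6] -/
theorem localWeilVHCComponentCM_of_hodgeConjecture (h : _root_.HodgeConjecture) (R : Polynomial ℤ)
    [Fact (Irreducible (realPolyQ R))] (e₀ k : ℕ) (δ : cmNormResidueGroup R) :
    LocalWeilVHCComponentCM R e₀ k δ :=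
  localWeilVHCAtComponentCM_of_hodgeConjecture h R e₀ k δ _

/-- The CM instance is WEAKER than W-VHC(δ)-CM. [cite: CharlesSchnell2014Notes, Conj. 11.3.1] -/
theorem localWeilVHCAtCMComponentCM_of_weilVariationalHodgeComponentCM
    (hV : WeilVariationalHodgeComponentCM R e₀ k δ) : LocalWeilVHCAtCMComponentCM R e₀ k δ :=
  localWeilVHCAtComponentCM_of_weilVariationalHodgeComponentCM hV _

/-- local-at-algebraic ⟹ local-at-CM (the germ is asked only where `W|` is algebraic anyway). [folklore] -/
theorem localWeilVHCAtCMComponentCM_of_localWeilVHCComponentCM (hL : LocalWeilVHCComponentCM R e₀ k δ) :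
    LocalWeilVHCAtCMComponentCM R e₀ k δ :=
  fun _ _ f hf h𝒳 hS hirrS hsm W hW hch s₀ _ hs₀ ↦ hL f hf h𝒳 hS hirrS hsm W hW hch s₀ hs₀ hs₀

/-- **EXACTNESS of the localisation: W-VHC(δ)-CM ⟺ the local germ at algebraic fibres** (Baire + Cattani–Deligne–Kaplan
/ Charles–Schnell over a smooth irreducible quasi-projective base, tree
`WeilTypeLadder.mem_algebraicClasses_of_isOpen_subset_algebraicityLocus`).
[cite: CharlesSchnell2014Notes, Prop. 11.3.11 (proof)] [cite: MumfordAV1970, §6 Lemma] -/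
theorem weilVariationalHodgeComponentCM_iff_local (R : Polynomial ℤ) [Fact (Irreducible (realPolyQ R))] (e₀ k : ℕ)
    (δ : cmNormResidueGroup R) : WeilVariationalHodgeComponentCM R e₀ k δ ↔ LocalWeilVHCComponentCM R e₀ k δ := by
  refine ⟨fun hV ↦ localWeilVHCAtComponentCM_of_weilVariationalHodgeComponentCM hV _, fun hL ↦ ?_⟩
  rintro 𝒳 S f hf h𝒳 hS hirrS hsm W hW hch ⟨s₀, hs₀⟩ s
  haveI := hirrS
  obtain ⟨U, hU, hs₀U, hUalg⟩ := hL f hf h𝒳 hS hirrS hsm W hW hch s₀ hs₀ hs₀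
  exact mem_algebraicClasses_of_isOpen_subset_algebraicityLocus f h𝒳 hS hsm hf W hU ⟨s₀, hs₀U⟩ hUalg s

/-! ### §3 The anchor engine with the LOCAL germ, and the rows -/

/-- **ANCHOR ENGINE of the component `(E, 2k, δ)`, LOCAL form.** Anchor valid (ambient dimension `2k·e₀`) + pointed
`(E, 2k, δ)`-Weil families with that anchor + the local germ at that anchor ⟹ the class target of the component: the
anchor makes `W|_{𝒳_{s₀}}` algebraic, the germ gives an open `U ∋ s₀` of algebraic fibres, Baire + Charles–Schnell makes
every fibre algebraic, read back along `ι : A.X ≅ 𝒳_{s₁}`. Compare the GLOBAL engine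
`weilClassesComponentCM_of_pointed_of_variational`. [cite: CharlesSchnell2014Notes, Prop. 11.3.11 (proof)]
[cite: BuchweitzFlenner2003, Thm. 5.1] [cite: Deligne1982HodgeCycles, §4 proof of Thm. 4.8 (strategy)] -/
theorem weilClassesComponentCM_of_pointed_of_local
    {anchor : (X : SchemeOver ℂ) → complexBetti X (2 * k) → Prop}
    (hvalid : ∀ (X : SchemeOver ℂ) (x : complexBetti X (2 * k)), anchor X x → IsRationalClass x →
      IsOfHodgeType (2 * k * e₀) X (2 * k) k k x → x ∈ algebraicClasses X k)
    (hP : PointedWeilFamiliesComponentCM R e₀ k δ anchor) (hL : LocalWeilVHCAtComponentCM R e₀ k δ anchor) :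
    WeilClassesComponentCM R e₀ k δ := by
  intro A η h hW hpol hRos hδ c hc hcQ hcH
  by_cases hc0 : c = 0
  · rw [hc0]; exact Submodule.zero_mem _
  obtain ⟨𝒳, S, f, s₁, s₀, ι, W, hf, h𝒳, hS, hirrS, hsm, hWs, hch, hread, hanch⟩ :=
    hP A η h hW hpol hRos hδ c hc hcQ hcH hc0
  haveI := hirrS
  have hs₀ : complexBetti.map (fiberι f s₀) (2 * k) W ∈ algebraicClasses (fiberOver f s₀) k :=
    hvalid _ _ hanch (hWs s₀).1 (hWs s₀).2
  obtain ⟨U, hU, hs₀U, hUalg⟩ := hL f hf h𝒳 hS hirrS hsm W hWs hch s₀ hanch hs₀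
  have h1 : complexBetti.map (fiberι f s₁) (2 * k) W ∈ algebraicClasses (fiberOver f s₁) k :=
    mem_algebraicClasses_of_isOpen_subset_algebraicityLocus f h𝒳 hS hsm hf W hU ⟨s₀, hs₀U⟩ hUalg s₁
  rw [← hread]
  exact (mem_algebraicClasses_map_iff_of_iso ι).2 h1

/-- **Row W1-CM-loc — the class target of `(E, 2k, δ)` from `HC_CM`, CM-pointed δ-families and the local germ AT CM
FIBRES.** CONDITIONAL on the three named hypotheses; `HC_CM` NOMINAL (row W1′-CM-loc).
[cite: Deligne1982HodgeCycles, §4 proof of Thm. 4.8 (a)–(c)] [cite: BuchweitzFlenner2003, Thm. 5.1] -/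
theorem weilClassesComponentCM_of_HC_CM_local (hCM : Theses.RankFourFaces.CMAbelianHodge)
    (hP : CMPointedWeilFamiliesComponentCM R e₀ k δ) (hL : LocalWeilVHCAtCMComponentCM R e₀ k δ) :
    WeilClassesComponentCM R e₀ k δ :=
  weilClassesComponentCM_of_pointed_of_local (cmAnchorOfDim_valid_of_HC_CM hCM (2 * k * e₀) k) hP hL

/-- **Row W1′-CM-loc — the same WITHOUT `HC_CM`**: divisor-generated CM-pointed δ-families (Deligne §5: members
isogenous to powers of CM abelian varieties on every component; `Hdg = Div` on the power is the CONDITION) and the local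
germ at divisor-generated CM fibres. [cite: Deligne1982HodgeCycles, §5] [cite: BuchweitzFlenner2003, Thm. 5.1] -/
theorem weilClassesComponentCM_of_divisorGeneratedCMPointed_local
    (hP : DivisorGeneratedCMPointedWeilFamiliesComponentCM R e₀ k δ)
    (hL : LocalWeilVHCAtComponentCM R e₀ k δ (divisorGeneratedCMAnchorOfDim (2 * k * e₀) k)) :
    WeilClassesComponentCM R e₀ k δ :=
  weilClassesComponentCM_of_pointed_of_local (divisorGeneratedCMAnchorOfDim_valid (2 * k * e₀) k) hP hL

/-- Row W1′-CM-loc with the germ asked at all CM fibres (antitonicity). NO `HC_CM`. [cite: Deligne1982HodgeCycles, §5] -/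
theorem weilClassesComponentCM_of_divisorGeneratedCMPointed_localCM
    (hP : DivisorGeneratedCMPointedWeilFamiliesComponentCM R e₀ k δ) (hL : LocalWeilVHCAtCMComponentCM R e₀ k δ) :
    WeilClassesComponentCM R e₀ k δ :=
  weilClassesComponentCM_of_divisorGeneratedCMPointed_local hP
    (hL.anti fun _ _ ⟨A₀, he₀, hA₀dim, hA₀cm, _⟩ ↦ ⟨A₀, he₀, hA₀dim, hA₀cm⟩)

/-- **Row W1″-CM-loc — anchored δ-families ∧ (local germ at algebraic fibres) ⟹ W(E, 2k, δ)** (= the anchored row of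
part VII-C through `weilVariationalHodgeComponentCM_iff_local`). [cite: CharlesSchnell2014Notes, Conj. 11.3.1] -/
theorem weilClassesComponentCM_of_anchored_of_local (hA : AnchoredWeilFamiliesComponentCM R e₀ k δ)
    (hL : LocalWeilVHCComponentCM R e₀ k δ) : WeilClassesComponentCM R e₀ k δ :=
  weilClassesComponentCM_of_pointed_of_local (algebraicAnchor_valid' (2 * k * e₀) k) hA hL

/-- All components at once from component-wise CM-pointed families and local germs at CM fibres, under `HC_CM`.
[cite: Deligne1982HodgeCycles, §4–5] -/
theorem weilClassesByComponentCM_of_HC_CM_local (hCM : Theses.RankFourFaces.CMAbelianHodge)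
    (hP : ∀ (R : Polynomial ℤ) [Fact (Irreducible (realPolyQ R))] (e₀ k : ℕ) (δ : cmNormResidueGroup R),
      2 ≤ e₀ → CMPointedWeilFamiliesComponentCM R e₀ k δ)
    (hL : ∀ (R : Polynomial ℤ) [Fact (Irreducible (realPolyQ R))] (e₀ k : ℕ) (δ : cmNormResidueGroup R),
      2 ≤ e₀ → LocalWeilVHCAtCMComponentCM R e₀ k δ) :
    WeilClassesByComponentCM :=
  fun R _ e₀ k δ he ↦ weilClassesComponentCM_of_HC_CM_local hCM (hP R e₀ k δ he) (hL R e₀ k δ he)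

/-- The same WITHOUT `HC_CM` (divisor-generated CM-pointed families on every component). [cite: Deligne1982HodgeCycles, §5] -/
theorem weilClassesByComponentCM_of_divisorGeneratedCMPointed_localCM
    (hP : ∀ (R : Polynomial ℤ) [Fact (Irreducible (realPolyQ R))] (e₀ k : ℕ) (δ : cmNormResidueGroup R),
      2 ≤ e₀ → DivisorGeneratedCMPointedWeilFamiliesComponentCM R e₀ k δ)
    (hL : ∀ (R : Polynomial ℤ) [Fact (Irreducible (realPolyQ R))] (e₀ k : ℕ) (δ : cmNormResidueGroup R),
      2 ≤ e₀ → LocalWeilVHCAtCMComponentCM R e₀ k δ) :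
    WeilClassesByComponentCM :=
  fun R _ e₀ k δ he ↦ weilClassesComponentCM_of_divisorGeneratedCMPointed_localCM (hP R e₀ k δ he) (hL R e₀ k δ he)

end Summit.HodgeConjecture.HodgeConjecture.Ring2.Hypotheses

end
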